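import Summits.ResolutionOfSingularities.ResolutionOfSingularities.Theorems.EquisingularLiftEquisingularLiftNatNonEquimultipleStrictTransform
import Literature.AlgebraicGeometry.Resolution.BlowupAlgebraStrictTransform
import HarnessLib

/-!
# [OURS · L1 W4.5(b) · EL♮(3)] E-NEG(1), part (iv)(c-2) — the TWO COMPARABLE PRIMES of the chart algebra of a NON-equimultiple hypersurface
# germ over the special point (pure algebra over res-L1-w45b-stub-2's ring core `…NatNonEquimultipleStrictTransform`, p543997; crux
# `EquisingularLiftNatThree` = stmt-ResolutionOfSingularities-20148, parent stmt-20038)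

NOT a statement of any manuscript. Helper file of the chain res-L1-w45b (cell `res-hironaka`, rung L, slot W4.5(b)); AI-written, weaker than
expert review; filed `--supports stmt-ResolutionOfSingularities-20148 --as helper`; it closes nothing. Object (O1) E-NEG(1) of res-L1-w45b-plan-1's
PLANNER-MEMO-g9-1 v1.1, conclusion (iv), scheme route step (c-2) (res-L1-w45b-plan-1 WORD 2026-08-27T15:36:49Z (2)).

SETTING. `A` a commutative ring, `x : Fin r → A` quasi-regular with `A/(x)` a domain, `ϖ ∈ A` with `I + (ϖ)` a proper prime (`I = (x)`; in E-NEG(1):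
`A = 𝒪_{E,q}`, `I` = the section, `I + (ϖ) = 𝔪`); `Φ` a form of degree `μ` whose coefficients all lie in `I + (ϖ)` (NON-equimultiplicity) but which is
non-zero modulo `I` on the chart `j` (`Φ̄_j ≠ 0`); `G = Φ(x)` (the hypersurface `D♭`); `φ : A ↠ S` a surjection onto a local ring with kernel `(G)`
(`S = 𝒪_{D♭,q}`) taking `I + (ϖ)` onto `𝔪_S`.

CONTENT.
* `coeff_mem_sup_span_of_eval_mem` — the COEFFICIENT CRITERION: if the reductions of `x` modulo `ϖ` are quasi-regular in `A/ϖ` and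
  `G mod ϖ ∈ Ī^{μ+1}` (`ord_q Ḡ > μ`), then every coefficient of `Φ` lies in `I + (ϖ)` (Matsumura's definition of quasi-regularity,
  `isQuasiRegular_def`) — the passage from «not equimultiple» to stub-2's coefficient hypothesis.
* `ker_blowupAlgebraMap_le_span_sup_span` — the kernel of the chart map `Ψ : A[I/x_j] ↠ S[φ(I)/φ(x_j)]` (`blowupAlgebraMap` along `φ`; the
  `x_j`-saturation of `(G)`, `mem_ker_blowupAlgebraMap_iff`) lies in `P₁ = (t, ϖ)` (stub-2's `iSup_colon_le_of_forall_coeff_mem`).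
* **`exists_chartPrimes_of_forall_coeff_mem`** — the images under `Ψ` of stub-2's primes `P₁ = (t, ϖ) < P₀ =` vertex are two COMPARABLE DISTINCT
  primes `𝔔₁ ≤ 𝔔₀` of `S[φ(I)/φ(x_j)]` lying over `𝔪_S` (needs a second variable, `r ≥ 2`) — the input of part (iv)(c-1)
  `not_chartPrimes_of_exactShadow` (p545525).

References: H. Matsumura, *Commutative Ring Theory* (1986), §16 Definition p. 124; U. Görtz, T. Wedhorn, *Algebraic Geometry I* (2020), Prop. 13.96 (2);
The Stacks Project, Tag 07Z3 — through the cited tree files.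
-/

set_option linter.dupNamespace false -- mandated namespace `Summit.<Summit>.<Problem>` of this single-conjunct summit

noncomputable section

open MvPolynomial IsLocalRing Literature.AlgebraicGeometry.Resolution

namespace Summit.ResolutionOfSingularities.ResolutionOfSingularities.Cruxes.EquisingularLiftNat.Sections

universe u

section ChartPrimes

variable {A : Type u} [CommRing A] {r : ℕ} (x : Fin r → A) (j : Fin r) (ϖ : A)

/-- **The coefficient criterion for NON-equimultiplicity.** If the reductions of `x` modulo `ϖ` form a quasi-regular sequence of `A/ϖ` and the
form `Φ` of degree `μ` has `Φ(x) mod ϖ ∈ Ī^{μ+1}` (`Ī = I·(A/ϖ)`: the reduction of the hypersurface `V(Φ(x))` has order `> μ` at the point), then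
every coefficient of `Φ` lies in `I + (ϖ)`. [cite: Matsumura1987, §16 Definition p. 124] [OURS · L1 W4.5b] -/
theorem coeff_mem_sup_span_of_eval_mem
    (hx : IsQuasiRegular (fun l => Ideal.Quotient.mk (Ideal.span {ϖ}) (x l))) {μ : ℕ} {Φ : MvPolynomial (Fin r) A}
    (hΦ : Φ.IsHomogeneous μ)
    (hG : Ideal.Quotient.mk (Ideal.span {ϖ}) (MvPolynomial.eval x Φ) ∈
      (Ideal.span (Set.range x)).map (Ideal.Quotient.mk (Ideal.span {ϖ})) ^ (μ + 1)) (n : Fin r →₀ ℕ) :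
    Φ.coeff n ∈ Ideal.span (Set.range x) ⊔ Ideal.span {ϖ} := by
  classical
  set π := Ideal.Quotient.mk (Ideal.span ({ϖ} : Set A)) with hπ
  have hrange : Ideal.span (Set.range fun l => π (x l)) = (Ideal.span (Set.range x)).map π := by
    rw [Ideal.map_span, ← Set.range_comp]; rfl
  have hΦbar : (MvPolynomial.map π Φ).IsHomogeneous μ := hΦ.map π
  have hev : MvPolynomial.eval (fun l => π (x l)) (MvPolynomial.map π Φ) = π (MvPolynomial.eval x Φ) := by
    have h := MvPolynomial.eval₂_comp_left π (RingHom.id A) x Φ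
    rw [RingHom.comp_id] at h
    rw [MvPolynomial.eval_map]
    exact h.symm
  have hmem : MvPolynomial.eval (fun l => π (x l)) (MvPolynomial.map π Φ) ∈ Ideal.span (Set.range fun l => π (x l)) ^ (μ + 1) := by
    rw [hev, hrange]; exact hG
  have hc := (isQuasiRegular_def _).mp hx μ (MvPolynomial.map π Φ) hΦbar hmem n
  rw [MvPolynomial.coeff_map, hrange, Ideal.mem_map_iff_of_surjective π Ideal.Quotient.mk_surjective] at hc
  obtain ⟨y, hy, hyc⟩ := hc
  have hdiff : Φ.coeff n - y ∈ Ideal.span {ϖ} := by rw [← Ideal.Quotient.eq, ← hπ, hyc]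
  have : Φ.coeff n = y + (Φ.coeff n - y) := by ring
  rw [this]
  exact Submodule.add_mem_sup hy hdiff

variable {S : Type u} [CommRing S]

/-- `φ(I) ≤ (φ ∘ x)` and conversely, for `I = (x)`. [folklore] -/
theorem map_span_range_eq_span_range_comp (φ : A →+* S) :
    (Ideal.span (Set.range x)).map φ = Ideal.span (Set.range fun l => φ (x l)) := by
  rw [Ideal.map_span, ← Set.range_comp]; rfl

/-- **The kernel of the chart map lies in `(t, ϖ)`.** For `φ : A → S` with kernel `(Φ(x))`, `Φ` a form of degree `μ` with all coefficients in
`I + (ϖ)` and `Φ̄_j ≠ 0` over `A/I` (`x` quasi-regular, `A/I` a domain), the kernel of `Ψ = blowupAlgebraMap φ : A[I/x_j] → S[φ(I)/φ(x_j)]` — the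
`x_j`-saturation of `(Φ(x))` — is contained in `P₁ = (t, ϖ)`. [cite: GortzWedhorn2020, Prop. 13.96 (2)] [OURS · L1 W4.5b] -/
theorem ker_blowupAlgebraMap_le_span_sup_span (hx : IsQuasiRegular x) [IsDomain (A ⧸ Ideal.span (Set.range x))]
    {μ : ℕ} (Φ : MvPolynomial (Fin r) A) (hΦd : Φ.IsHomogeneous μ)
    (hΦi : MvPolynomial.map (Ideal.Quotient.mk (Ideal.span (Set.range x))) (dehomogenize j Φ) ≠ 0)
    (hΦ : ∀ α, Φ.coeff α ∈ Ideal.span (Set.range x) ⊔ Ideal.span {ϖ})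
    (φ : A →+* S) (hker : RingHom.ker φ = Ideal.span {MvPolynomial.eval x Φ}) :
    RingHom.ker (blowupAlgebraMap φ (Ideal.span (Set.range x)) (Ideal.span (Set.range fun l => φ (x l))) (x j)
        (map_span_range_eq_span_range_comp x φ).le) ≤
      Ideal.span {algebraMap A (blowupAlgebra (Ideal.span (Set.range x)) (x j)) (x j)} ⊔
        Ideal.span {algebraMap A (blowupAlgebra (Ideal.span (Set.range x)) (x j)) ϖ} := by
  classical
  -- `G = t^μ · g₁` on the chart
  obtain ⟨ψ, hψ⟩ := exists_algebraMap_tangentCone_eq x j hΦd (Ψ := 0) (Ideal.zero_mem _)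
  rw [add_zero] at hψ
  intro y hy
  obtain ⟨N, hN⟩ := (mem_ker_blowupAlgebraMap_iff φ _ _ (x j) _ y).mp hy
  rw [hker, Ideal.map_span, Set.image_singleton] at hN
  refine iSup_colon_le_of_forall_coeff_mem x j hx ϖ Φ hΦi hΦ ψ hψ ?_
  refine Ideal.mem_iSup_of_mem N ?_
  rw [Submodule.mem_colon]
  intro p hp
  rw [Ideal.span_singleton_pow] at hp
  obtain ⟨b, rfl⟩ := Ideal.mem_span_singleton'.mp hp
  rw [smul_eq_mul, show y * (b * algebraMap A _ (x j) ^ N) = b * (algebraMap A _ (x j) ^ N * y) by ring]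
  exact Ideal.mul_mem_left _ _ hN

variable [IsLocalRing S]

/-- **The two comparable primes over the special point.** In the SETTING (module docstring), with a second variable available (`l₀ ≠ j`): the chart
algebra `S[φ(I)/φ(x_j)]` of `S = A/(G)` has two DISTINCT primes `𝔔₁ ≤ 𝔔₀` lying over `𝔪_S` — the images under the chart surjection
`Ψ = blowupAlgebraMap φ` of stub-2's primes `P₁ = (t, ϖ)` (generic point of the exceptional fibre chart) and `P₀` (its vertex), both of which contain
`ker Ψ`. [cite: GortzWedhorn2020, Prop. 13.96 (2); StacksProject, Tag 07Z3] [OURS · L1 W4.5b] -/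
theorem exists_chartPrimes_of_forall_coeff_mem (hx : IsQuasiRegular x) [IsDomain (A ⧸ Ideal.span (Set.range x))]
    [(Ideal.span (Set.range x) ⊔ Ideal.span {ϖ}).IsPrime] (l₀ : {l : Fin r // l ≠ j})
    {μ : ℕ} (Φ : MvPolynomial (Fin r) A) (hΦd : Φ.IsHomogeneous μ)
    (hΦi : MvPolynomial.map (Ideal.Quotient.mk (Ideal.span (Set.range x))) (dehomogenize j Φ) ≠ 0)
    (hΦ : ∀ α, Φ.coeff α ∈ Ideal.span (Set.range x) ⊔ Ideal.span {ϖ})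
    (φ : A →+* S) (hφ : Function.Surjective φ) (hker : RingHom.ker φ = Ideal.span {MvPolynomial.eval x Φ})
    (h𝔪 : (Ideal.span (Set.range x) ⊔ Ideal.span {ϖ}).map φ = maximalIdeal S) :
    ∃ 𝔔₁ 𝔔₀ : PrimeSpectrum (blowupAlgebra (Ideal.span (Set.range fun l => φ (x l))) (φ (x j))),
      𝔔₁.asIdeal.comap (algebraMap S _) = maximalIdeal S ∧ 𝔔₀.asIdeal.comap (algebraMap S _) = maximalIdeal S ∧
      𝔔₁.asIdeal ≤ 𝔔₀.asIdeal ∧ 𝔔₁ ≠ 𝔔₀ := by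
  classical
  have hIJ := (map_span_range_eq_span_range_comp x φ).le
  have hJI := (map_span_range_eq_span_range_comp x φ).ge
  set Ψ := blowupAlgebraMap φ (Ideal.span (Set.range x)) (Ideal.span (Set.range fun l => φ (x l))) (x j) hIJ with hΨ
  have hΨsurj : Function.Surjective Ψ := blowupAlgebraMap_surjective φ _ _ (x j) hφ hIJ hJI
  have h𝔪A : Ideal.span (Set.range x) ⊔ Ideal.span {ϖ} ≠ ⊤ := Ideal.IsPrime.ne_top'
  -- stub-2's two primes upstairs
  set P₁ : Ideal (blowupAlgebra (Ideal.span (Set.range x)) (x j)) :=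
    Ideal.span {algebraMap A (blowupAlgebra (Ideal.span (Set.range x)) (x j)) (x j)} ⊔
      Ideal.span {algebraMap A (blowupAlgebra (Ideal.span (Set.range x)) (x j)) ϖ} with hP₁
  set P₀ : Ideal (blowupAlgebra (Ideal.span (Set.range x)) (x j)) :=
    ((Ideal.span (Set.range x) ⊔ Ideal.span {ϖ}).comap
        (MvPolynomial.constantCoeff : MvPolynomial {l : Fin r // l ≠ j} A →+* A)).map (blowupAlgebra.eval x j).toRingHom with hP₀
  haveI hP₁p : P₁.IsPrime := isPrime_span_sup_span x j hx ϖ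
  haveI hP₀p : P₀.IsPrime := isPrime_map_eval_comap_constantCoeff x j hx ϖ
  have hle : P₁ ≤ P₀ := span_sup_span_le_map_eval_comap_constantCoeff x j ϖ
  have hne : P₁ ≠ P₀ := span_sup_span_ne_map_eval_comap_constantCoeff x j hx ϖ h𝔪A l₀
  have hc₁ : P₁.comap (algebraMap A _) = Ideal.span (Set.range x) ⊔ Ideal.span {ϖ} := comap_algebraMap_span_sup_span x j hx ϖ
  have hc₀ : P₀.comap (algebraMap A _) = Ideal.span (Set.range x) ⊔ Ideal.span {ϖ} :=
    comap_algebraMap_map_eval_comap_constantCoeff x j hx ϖ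
  -- both contain the kernel of the chart surjection
  have hk₁ : RingHom.ker Ψ ≤ P₁ := ker_blowupAlgebraMap_le_span_sup_span x j ϖ hx Φ hΦd hΦi hΦ φ hker
  have hk₀ : RingHom.ker Ψ ≤ P₀ := hk₁.trans hle
  -- their images
  have hcomap : ∀ P : Ideal (blowupAlgebra (Ideal.span (Set.range x)) (x j)), RingHom.ker Ψ ≤ P → (P.map Ψ).comap Ψ = P :=
    fun P hP => by rw [Ideal.comap_map_of_surjective Ψ hΨsurj, sup_eq_left.mpr (by rwa [← RingHom.ker_eq_comap_bot])]
  have hover : ∀ P : Ideal (blowupAlgebra (Ideal.span (Set.range x)) (x j)), RingHom.ker Ψ ≤ P →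
      P.comap (algebraMap A _) = Ideal.span (Set.range x) ⊔ Ideal.span {ϖ} →
      (P.map Ψ).comap (algebraMap S _) = maximalIdeal S := by
    intro P hP hPc
    ext s
    obtain ⟨a, rfl⟩ := hφ s
    rw [Ideal.mem_comap, ← blowupAlgebraMap_algebraMap φ _ _ (x j) hIJ a, ← hΨ]
    constructor
    · intro h
      have h1 : algebraMap A _ a ∈ (P.map Ψ).comap Ψ := h
      rw [hcomap P hP, ← Ideal.mem_comap, hPc] at h1
      rw [← h𝔪]
      exact Ideal.mem_map_of_mem _ h1
    · intro h
      rw [← h𝔪, Ideal.mem_map_iff_of_surjective φ hφ] at h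
      obtain ⟨a', ha', he⟩ := h
      have h2 : algebraMap A (blowupAlgebra (Ideal.span (Set.range x)) (x j)) a' ∈ P := by
        rw [← Ideal.mem_comap, hPc]; exact ha'
      have h3 : Ψ (algebraMap A _ a') = Ψ (algebraMap A _ a) := by
        rw [hΨ, blowupAlgebraMap_algebraMap, blowupAlgebraMap_algebraMap, he]
      rw [← h3]
      exact Ideal.mem_map_of_mem _ h2
  refine ⟨⟨P₁.map Ψ, Ideal.map_isPrime_of_surjective hΨsurj hk₁⟩, ⟨P₀.map Ψ, Ideal.map_isPrime_of_surjective hΨsurj hk₀⟩,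
    hover P₁ hk₁ hc₁, hover P₀ hk₀ hc₀, Ideal.map_mono hle, fun h => hne ?_⟩
  have h' : P₁.map Ψ = P₀.map Ψ := congrArg PrimeSpectrum.asIdeal h
  rw [← hcomap P₁ hk₁, ← hcomap P₀ hk₀, h']

end ChartPrimes

end Summit.ResolutionOfSingularities.ResolutionOfSingularities.Cruxes.EquisingularLiftNat.Sections

end
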